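import Mathlib
import HarnessLib
import Summits.HubbardSuperconductivity.HubbardSuperconductivity.Theorems.KLProgrammeFermiSurfaceFSTInversion

/-!
# Route `KLProgramme` (cruxes K3/K1, risk r2): the Hubbard band IS in FST IV's class `𝓔(δ₀, g₀, G₀, w₀)`
# for `μ < -2` — FST III norms of the band, explicit constants, and «membership iff `μ < -2`»

Cell `gate-hubbard-kl`, seat fs-1; sequel of `KLProgrammeFermiSurfaceFSTInversion.lean` (which proves that for
`-2 ≤ μ < 0` the free band `E = ε - μ` is OUTSIDE the typed class `FST4.InDispersionClass` of
`FermiRG/FSTInversion.lean` for every fundamental cell — umklapp). Here, with `Γ# = 2πℤ²` and the open cell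
`𝓕 = (-π,π)²` of FST IV p.4:

* §2 the FST III norms of `E` (`FST3.CkHolderNormLE k 0`, `|f|_k = Σ_{|α|≤k} sup |D^α f|`): every coordinate
  partial `D^α E` is `E` itself or `a sin pᵢ + b cos pᵢ` with `|a| + |b| ≤ 2` (`klfs_iterPartial_e`), whence
  `|E|_k ≤ (k+1)² (4 + |μ|)` for every `k` (`klfs_fst4_ckHolderNormLE`) — in particular the `C³` bound
  `|E|₃ ≤ G₃` that `FST4.theorem1` asks for (the free band meets it; DECOMP §2 C4a);
* §3 **for `-4 < μ < -2` the band IS in `𝓔(δ₀, g₀, G₀, w₀)`** for every `δ₀ < π/2 - K(μ)`,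
  `g₀ < √(-μ(4+μ))`, `G₀ > 9 (4 - μ)`, `w₀ < -μ/2`, `K(μ) = arccos(-μ/2 - 1) = umklappRadius μ < π/2`
  (`klfs_fst4_inDispersionClass`); and the on-site interaction `v̂ ≡ U`, `|U| ≤ 1`, is in the class `𝓥`
  (`klfs_fst4_inInteractionClass_onsite`);
* §4 so for `-4 < μ < 0`: `E ∈ 𝓔(δ₀,g₀,G₀,w₀)` for SOME admissible constants **iff `μ < -2`**
  (`klfs_fst4_inDispersionClass_iff`) — the class of the inversion theorem is exactly FST II's no-umklapp
  regime «`n < 0.369`» and excludes both programme windows.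

No definitions; everything PROVED. [folklore]
-/

noncomputable section

open Real Set

-- the tree's namespace `Summit.<Summit>.<Problem>.Theorems` repeats the summit name by design (D-0017)
set_option linter.dupNamespace false

namespace Summit.HubbardSuperconductivity.HubbardSuperconductivity.Theorems

open Literature.MathematicalPhysics.QuantumLattice

/-! ### §2 The FST III norms `|E|_k`: all coordinate partials of the band -/

/-- The coordinate trigonometric functions `a sin pᵢ + b cos pᵢ` have derivative
`(a cos pᵢ - b sin pᵢ) Pᵢ`. [folklore] -/
theorem klfs_hasFDerivAt_trig (i : Fin 2) (a b : ℝ) (z : Momentum) :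
    HasFDerivAt (fun q : Momentum => a * Real.sin (q i) + b * Real.cos (q i))
      ((a * Real.cos (z i) - b * Real.sin (z i)) • (PiLp.proj 2 (fun _ : Fin 2 => ℝ) i : Momentum →L[ℝ] ℝ)) z := by
  set P : Momentum →L[ℝ] ℝ := PiLp.proj 2 (fun _ : Fin 2 => ℝ) i with hP
  have hs : HasFDerivAt (fun q : Momentum => Real.sin (P q)) (Real.cos (P z) • P) z :=
    (Real.hasDerivAt_sin (P z)).comp_hasFDerivAt z P.hasFDerivAt
  have hc : HasFDerivAt (fun q : Momentum => Real.cos (P q)) (-Real.sin (P z) • P) z :=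
    (Real.hasDerivAt_cos (P z)).comp_hasFDerivAt z P.hasFDerivAt
  have h := (hs.const_mul a).add (hc.const_mul b)
  refine h.congr_fderiv ?_
  ext q
  simp [hP]
  ring

/-- `∂ⱼ (a sin pᵢ + b cos pᵢ) = -b sin pᵢ + a cos pᵢ` if `j = i`, and `0` otherwise. [folklore] -/
theorem klfs_partialD_trig (j i : Fin 2) (a b : ℝ) :
    FermiRG.FST3.partialD j (fun q : Momentum => a * Real.sin (q i) + b * Real.cos (q i)) =
      if j = i then (fun q : Momentum => -b * Real.sin (q i) + a * Real.cos (q i)) else fun _ => 0 := by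
  funext z
  rw [FermiRG.FST3.partialD, (klfs_hasFDerivAt_trig i a b z).fderiv]
  by_cases hji : j = i
  · subst hji
    simp
    ring
  · simp [hji, Ne.symm hji]

/-- `∂ⱼ E = 2 sin pⱼ` (`= 2 sin pⱼ + 0 · cos pⱼ`). [folklore] -/
theorem klfs_partialD_e (μ : ℝ) (j : Fin 2) :
    FermiRG.FST3.partialD j (fun q : Momentum => squareDispersion 1 0 q - μ) =
      fun q : Momentum => 2 * Real.sin (q j) + 0 * Real.cos (q j) := by
  funext z
  rw [FermiRG.FST3.partialD, klfs_fderiv_e]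
  fin_cases j <;> simp

/-- `iterPartial (j :: l) f = ∂ⱼ (iterPartial l f)` (unfolding). [folklore] -/
theorem klfs_iterPartial_cons {F : Type*} [NormedAddCommGroup F] [NormedSpace ℝ F] (j : Fin 2)
    (l : List (Fin 2)) (f : Momentum → F) :
    FermiRG.FST3.iterPartial (j :: l) f = FermiRG.FST3.partialD j (FermiRG.FST3.iterPartial l f) := rfl

/-- **Every non-trivial iterated coordinate partial of `E` is `a sin pᵢ + b cos pᵢ` with `|a| + |b| ≤ 2`.**
[folklore] -/
theorem klfs_iterPartial_e (μ : ℝ) (l : List (Fin 2)) (hl : l ≠ []) :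
    ∃ (i : Fin 2) (a b : ℝ), |a| + |b| ≤ 2 ∧
      FermiRG.FST3.iterPartial l (fun q : Momentum => squareDispersion 1 0 q - μ) =
        fun q : Momentum => a * Real.sin (q i) + b * Real.cos (q i) := by
  induction l with
  | nil => exact absurd rfl hl
  | cons j l ih =>
      rw [klfs_iterPartial_cons]
      by_cases hl' : l = []
      · subst hl'
        refine ⟨j, 2, 0, by norm_num, ?_⟩
        show FermiRG.FST3.partialD j (fun q : Momentum => squareDispersion 1 0 q - μ) = _
        rw [klfs_partialD_e]
      · obtain ⟨i, a, b, hab, hl⟩ := ih hl'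
        rw [hl, klfs_partialD_trig]
        by_cases hji : j = i
        · refine ⟨i, -b, a, by rw [abs_neg]; linarith, ?_⟩
          rw [if_pos hji]
        · refine ⟨i, 0, 0, by norm_num, ?_⟩
          rw [if_neg hji]
          funext q; simp

/-- `|a sin t + b cos t| ≤ |a| + |b|`. [folklore] -/
theorem klfs_abs_trig_le (a b t : ℝ) : |a * Real.sin t + b * Real.cos t| ≤ |a| + |b| := by
  calc |a * Real.sin t + b * Real.cos t| ≤ |a * Real.sin t| + |b * Real.cos t| := abs_add_le _ _
    _ ≤ |a| + |b| := by
        rw [abs_mul, abs_mul]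
        have h1 := Real.abs_sin_le_one t
        have h2 := Real.abs_cos_le_one t
        nlinarith [abs_nonneg a, abs_nonneg b]

/-- `|E(p)| ≤ 4 + |μ|`. [folklore] -/
theorem klfs_abs_e_le (μ : ℝ) (p : Momentum) : |squareDispersion 1 0 p - μ| ≤ 4 + |μ| := by
  have h0 := Real.abs_cos_le_one (p 0)
  have h1 := Real.abs_cos_le_one (p 1)
  have h : |squareDispersion 1 0 p| ≤ 4 := by
    simp only [squareDispersion, mul_zero, zero_mul, sub_zero, mul_one]
    rw [abs_mul]
    have := abs_add_le (Real.cos (p 0)) (Real.cos (p 1))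
    have h2 : |(-2 : ℝ)| = 2 := by norm_num
    rw [h2]; nlinarith
  calc |squareDispersion 1 0 p - μ| ≤ |squareDispersion 1 0 p| + |μ| := abs_sub _ _
    _ ≤ 4 + |μ| := by linarith

/-- **Every coordinate partial `D^α E` is bounded by `4 + |μ|`** (by `2` if `α ≠ 0`). [folklore] -/
theorem klfs_norm_multiPartial_e_le (μ : ℝ) (α : Fin 2 → ℕ) (p : Momentum) :
    ‖FermiRG.FST3.multiPartial α (fun q : Momentum => squareDispersion 1 0 q - μ) p‖ ≤ 4 + |μ| := by
  unfold FermiRG.FST3.multiPartial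
  set l := (List.finRange 2).flatMap fun i => List.replicate (α i) i with hl
  by_cases hl0 : l = []
  · rw [hl0]
    show ‖squareDispersion 1 0 p - μ‖ ≤ 4 + |μ|
    rw [Real.norm_eq_abs]; exact klfs_abs_e_le μ p
  · obtain ⟨i, a, b, hab, h⟩ := klfs_iterPartial_e μ l hl0
    rw [h, Real.norm_eq_abs]
    exact (klfs_abs_trig_le a b (p i)).trans (by linarith [abs_nonneg μ])

/-- There are at most `(k+1)²` multi-indices `α ∈ ℕ²` with `|α| ≤ k` in FST III's index set. [folklore] -/
theorem klfs_card_multiIndicesLE_le (k : ℕ) : (FermiRG.FST3.multiIndicesLE 2 k).card ≤ (k + 1) ^ 2 := by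
  unfold FermiRG.FST3.multiIndicesLE
  calc _ ≤ ((Finset.univ : Finset (Fin 2 → Fin (k + 1))).image fun α i => (α i : ℕ)).card :=
        Finset.card_filter_le _ _
    _ ≤ (Finset.univ : Finset (Fin 2 → Fin (k + 1))).card := Finset.card_image_le
    _ = (k + 1) ^ 2 := by simp [Fintype.card_fin]

/-- **`|E|_k ≤ (k+1)² (4 + |μ|)`** in FST III's norm `|f|_k = Σ_{|α| ≤ k} sup |D^α f|` (`h = 0`), for every
`k` — in particular the `C³` bound `|E|₃ ≤ G₃` of `FST4.theorem1` with `G₃ = 16 (4 + |μ|)`. [folklore] -/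
theorem klfs_fst4_ckHolderNormLE (μ : ℝ) (k : ℕ) :
    FermiRG.FST3.CkHolderNormLE k 0 (fun q : Momentum => squareDispersion 1 0 q - μ)
      (((k : ℝ) + 1) ^ 2 * (4 + |μ|)) := by
  refine ⟨fun _ => 4 + |μ|, 0, fun α _ p => klfs_norm_multiPartial_e_le μ α p, le_rfl,
    fun h => absurd h (lt_irrefl 0), ?_⟩
  rw [Finset.sum_const, nsmul_eq_mul, add_zero]
  have hc : ((FermiRG.FST3.multiIndicesLE 2 k).card : ℝ) ≤ ((k : ℝ) + 1) ^ 2 := by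
    exact_mod_cast klfs_card_multiIndicesLE_le k
  have hpos : 0 ≤ 4 + |μ| := by positivity
  nlinarith

/-- `E` is `C^k` for every `k` — in particular `C³`, as `FST4.theorem1` asks. [folklore] -/
theorem klfs_fst4_contDiff_three (μ : ℝ) : ContDiff ℝ 3 (fun q : Momentum => squareDispersion 1 0 q - μ) :=
  klfs_contDiff_e μ

/-! ### §3 `-4 < μ < -2`: the band IS in `𝓔(δ₀, g₀, G₀, w₀)` for the open cell, explicit constants -/

/-- `𝓕₂` of the open cell is the open half-cell `(-π/2, π/2)²`. [folklore] -/
theorem klfs_fund₂_openCell (L : FermiRG.FST4.LatticeData 2) (hFo : L.fund = {p : Momentum | ∀ i, |p i| < π}) :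
    L.fund₂ = {p : Momentum | ∀ i, |p i| < π / 2} := by
  ext p
  simp only [FermiRG.FST4.LatticeData.fund₂, hFo, mem_inter_iff, mem_preimage, mem_setOf_eq,
    PiLp.smul_apply, smul_eq_mul]
  constructor
  · rintro ⟨-, h2⟩ i
    have := h2 i
    rw [abs_mul, abs_two] at this
    linarith
  · intro h
    refine ⟨fun i => by linarith [h i, Real.pi_pos], fun i => ?_⟩
    rw [abs_mul, abs_two]
    linarith [h i]

/-- The open half-cell is open. [folklore] -/
theorem klfs_isOpen_halfCell : IsOpen {p : Momentum | ∀ i, |p i| < π / 2} := by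
  have h : {p : Momentum | ∀ i, |p i| < π / 2} = ⋂ i, {p : Momentum | |p i| < π / 2} := by
    ext p; simp
  rw [h]
  exact isOpen_iInter_of_finite fun i =>
    isOpen_lt (continuous_abs.comp (PiLp.continuous_apply 2 _ i)) continuous_const

/-- **FST IV's class contains the Hubbard band for `-4 < μ < -2`** (open cell `(-π,π)²`, `Γ# = 2πℤ²`), with
every `δ₀ < π/2 - K(μ)`, `g₀ < √(-μ(4+μ))`, `G₀ > 9 (4 - μ)`, `w₀ < -μ/2`: (i) every level point has a cell
representative with coordinates `≤ K(μ) < π/2` (`abs_le_umklappRadius_of_sqDispersion_eq`), `E(0) < 0`,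
`E(π,π) > 0`, and the representatives keep distance `≥ π/2 - K(μ)` from `∂𝓕₂`; (ii) `‖∇E‖ ≥ √(-μ(4+μ))`;
(iii) `|E|₂ ≤ 9 (4 + |μ|)`; (iv) `(t, E'' t) ≥ -μ/2` on unit tangents (`klfs_hessQuad_tangent_ge`).
[folklore] -/
theorem klfs_fst4_inDispersionClass {μ : ℝ} (hμ₁ : -4 < μ) (hμ₂ : μ < -2) (L : FermiRG.FST4.LatticeData 2)
    (hL : L.latt = ((FermiRG.Crystal.cubic 2).dualLattice : Set Momentum))
    (hFo : L.fund = {p : Momentum | ∀ i, |p i| < π})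
    {δ₀ g₀ G₀ w₀ : ℝ} (hδ : δ₀ < π / 2 - umklappRadius μ) (hg : g₀ < Real.sqrt (-μ * (4 + μ)))
    (hG : 9 * (4 - μ) < G₀) (hw : w₀ < -μ / 2) :
    FermiRG.FST4.InDispersionClass L δ₀ g₀ G₀ w₀ (fun p : Momentum => squareDispersion 1 0 p - μ) := by
  have hμ0 : μ < 0 := by linarith
  have hf2 := klfs_fund₂_openCell L hFo
  -- level equation in coordinates
  have hlev : ∀ p : Momentum, squareDispersion 1 0 p - μ = 0 → sqDispersion (WithLp.ofLp p) = μ := by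
    intro p hp; rw [← squareDispersion_one_zero_eq_sqDispersion]; linarith
  refine ⟨⟨klfs_contDiff_e μ, ?_, fun p => by simp only [klfs_squareDispersion_neg]⟩, ?_, ⟨0, ?_⟩,
    ⟨WithLp.toLp 2 ![π, π], ?_⟩, ⟨π / 2 - umklappRadius μ, hδ, ?_⟩, ?_, ⟨9 * (4 - μ), hG, ?_⟩, ?_⟩
  · -- periodic
    intro γ hγ p
    rw [hL] at hγ
    exact klfs_isLatticePeriodic_e μ γ hγ p
  · -- (i) `S(E) ⊂ 𝓕₂`
    intro p hp
    obtain ⟨g, hg, -⟩ := (FermiRG.Crystal.cubic 2).existsUnique_rep p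
    refine ⟨(g : Momentum), by rw [hL]; exact g.2, ?_⟩
    rw [hf2]
    intro i
    have hcell : ∀ j, |(p + (g : Momentum)) j| ≤ π := fun j => by
      have h := (klfs_mem_cubic_fundamentalDomain.1 hg) j
      exact abs_le.2 ⟨h.1, h.2.le⟩
    have hE : squareDispersion 1 0 (p + (g : Momentum)) - μ = 0 := by
      have hper := klfs_isLatticePeriodic_e μ (g : Momentum) g.2 p
      beta_reduce at hper hp
      rw [hper]; exact hp
    exact (abs_le_umklappRadius_of_sqDispersion_eq hcell (hlev _ hE) i).trans_lt
      (umklappRadius_lt_pi_div_two hμ₁.le hμ₂)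
  · -- `E(0) < 0`
    simp [squareDispersion]; linarith
  · -- `E(π, π) ≥ 0`
    simp [squareDispersion]; linarith
  · -- distance to `∂𝓕₂`
    intro p hp hpF x hx
    rw [hf2] at hpF hx
    rw [klfs_isOpen_halfCell.frontier_eq] at hx
    obtain ⟨-, hxout⟩ := hx
    simp only [mem_setOf_eq, not_forall, not_lt] at hxout
    obtain ⟨i, hi⟩ := hxout
    have hcell : ∀ j, |p j| ≤ π := fun j => by linarith [hpF j, Real.pi_pos]
    have hpi := abs_le_umklappRadius_of_sqDispersion_eq hcell (hlev _ hp) i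
    calc π / 2 - umklappRadius μ ≤ |x i| - |p i| := by linarith
      _ ≤ |p i - x i| := by
          have := abs_sub_abs_le_abs_sub (x i) (p i); rw [abs_sub_comm] at this; linarith
      _ = ‖(p - x) i‖ := by rw [PiLp.sub_apply, Real.norm_eq_abs]
      _ ≤ ‖p - x‖ := PiLp.norm_apply_le (p - x) i
      _ = dist p x := (dist_eq_norm p x).symm
  · -- (ii) gradient
    intro p hp
    have he : -2 * (Real.cos (p 0) + Real.cos (p 1)) = μ := by
      have := hlev p hp; simp [sqDispersion] at this; linarith
    rw [klfs_gradient_level, norm_gradient_squareDispersion, klfs_two_mul_sqrt]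
    exact hg.trans_le (Real.sqrt_le_sqrt (klfs_fermiSpeedSq_mem_Icc he).1)
  · -- (iii) `|E|₂ ≤ 9 (4 - μ)`
    have h := klfs_fst4_ckHolderNormLE μ 2
    rw [abs_of_neg hμ0] at h
    convert h using 1
    ring
  · -- (iv) curvature
    intro p hp t ht hinner
    change w₀ < FermiRG.hessQuad (fun q : Momentum => squareDispersion 1 0 q - μ) p t
    have hp' : p ∈ FermiRG.fermiSurface (fun q : Momentum => squareDispersion 1 0 q - μ) := hp
    rw [real_inner_comm] at hinner
    have h := klfs_hessQuad_tangent_ge hμ₁ hμ0 hp' hinner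
    have ht2 : t 0 ^ 2 + t 1 ^ 2 = 1 := by
      have := EuclideanSpace.real_norm_sq_eq t
      rw [ht, Fin.sum_univ_two] at this
      linarith
    rw [ht2, mul_one] at h
    exact hw.trans_le h

/-- All non-trivial iterated coordinate partials of a constant vanish. [folklore] -/
theorem klfs_iterPartial_const {n : ℕ} {F : Type*} [NormedAddCommGroup F] [NormedSpace ℝ F] (c : F)
    (l : List (Fin n)) (hl : l ≠ []) :
    FermiRG.FST3.iterPartial l (fun _ : FermiRG.FST3.Mom n => c) = 0 := by
  induction l with
  | nil => exact absurd rfl hl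
  | cons j l ih =>
      show FermiRG.FST3.partialD j (FermiRG.FST3.iterPartial l fun _ : FermiRG.FST3.Mom n => c) = 0
      by_cases hl' : l = []
      · subst hl'
        funext z
        simp [FermiRG.FST3.iterPartial, FermiRG.FST3.partialD]
      · rw [ih hl']; exact FermiRG.FST3.partialD_zero j

/-- `D^α c = c` for `α = 0` and `D^α c = 0` otherwise, for a constant `c`. [folklore] -/
theorem klfs_multiPartial_const {n : ℕ} {F : Type*} [NormedAddCommGroup F] [NormedSpace ℝ F] (c : F)
    (α : Fin n → ℕ) :
    FermiRG.FST3.multiPartial α (fun _ : FermiRG.FST3.Mom n => c) =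
      if α = 0 then (fun _ : FermiRG.FST3.Mom n => c) else 0 := by
  unfold FermiRG.FST3.multiPartial
  set l := (List.finRange n).flatMap fun i => List.replicate (α i) i with hl
  by_cases hl0 : l = []
  · have hα : α = 0 := by
      funext i
      have hi : List.replicate (α i) i = [] := List.flatMap_eq_nil_iff.1 hl0 i (List.mem_finRange i)
      simpa using hi
    rw [hl0, if_pos hα]
    rfl
  · have hα : α ≠ 0 := by
      rintro rfl
      exact hl0 (by simp [hl])
    rw [if_neg hα]
    exact klfs_iterPartial_const c l hl0

/-- **A constant has FST III norm `|c|_{k,h} = ‖c‖`** for every `k` and `h` (only `D^0 c = c` is non-zero,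
and all Hölder quotients vanish). [folklore] -/
theorem klfs_ckHolderNormLE_const {n : ℕ} {F : Type*} [NormedAddCommGroup F] [NormedSpace ℝ F] (k : ℕ)
    (h : ℝ) (c : F) : FermiRG.FST3.CkHolderNormLE k h (fun _ : FermiRG.FST3.Mom n => c) ‖c‖ := by
  refine ⟨fun α => if α = 0 then ‖c‖ else 0, 0, fun α _ p => ?_, le_rfl, fun _ α _ x y => ?_, ?_⟩
  · show _ ≤ (if α = 0 then ‖c‖ else 0)
    rw [klfs_multiPartial_const]
    split_ifs
    · exact le_rfl
    · simp
  · rw [klfs_multiPartial_const]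
    split_ifs <;> simp
  · rw [add_zero, Finset.sum_ite_eq']
    split_ifs
    · exact le_rfl
    · exact norm_nonneg _

/-- **The on-site Hubbard interaction `v̂ ≡ U` is in FST IV's class `𝓥`** whenever `|U| ≤ 1` (FST IV p.4:
«the `1` in the condition `|v̂|₂ ≤ 1` is not a restriction, since a rescaling of `V` can be absorbed by a
rescaling of `λ`»): constants are periodic, `C²` with `|U|₂ = |U|`, real, even, and their own `p₀ → ∞` limit.
[folklore] -/
theorem klfs_fst4_inInteractionClass_onsite (L : FermiRG.FST4.LatticeData 2) {U : ℝ} (hU : |U| ≤ 1) :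
    FermiRG.FST4.InInteractionClass L (fun _ : FermiRG.FST3.Mom 3 => (U : ℂ)) := by
  have hnorm : FermiRG.FST3.CkHolderNormLE 2 0 (fun _ : FermiRG.FST3.Mom 3 => (U : ℂ)) 1 :=
    (klfs_ckHolderNormLE_const 2 0 (U : ℂ)).mono (by rwa [Complex.norm_real, Real.norm_eq_abs])
  refine ⟨fun _ _ _ => rfl, contDiff_const, hnorm, fun _ => by simp, fun _ => rfl, fun _ => U,
    fun _ _ _ => rfl, contDiff_const, ⟨|U|, fun _ => le_of_eq (Real.norm_eq_abs U)⟩, 1, 0, 0, one_pos, ?_⟩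
  intro q _
  simp

/-! ### §4 `-4 < μ < 0`: membership iff `μ < -2` -/

/-- **For the open cell and `-4 < μ < 0`: the Hubbard band lies in `𝓔(δ₀, g₀, G₀, w₀)` for SOME admissible
constants iff `μ < -2`** — the dispersion class of the FST inversion theorem is exactly the no-umklapp
regime (FST II's «`n < 0.369`»), and excludes both programme windows. [folklore] -/
theorem klfs_fst4_inDispersionClass_iff {μ : ℝ} (hμ₁ : -4 < μ) (hμ₂ : μ < 0) (L : FermiRG.FST4.LatticeData 2)
    (hL : L.latt = ((FermiRG.Crystal.cubic 2).dualLattice : Set Momentum))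
    (hFo : L.fund = {p : Momentum | ∀ i, |p i| < π}) :
    (∃ δ₀ g₀ G₀ w₀ : ℝ, FermiRG.FST4.AdmissibleConstants δ₀ g₀ G₀ w₀ ∧
        FermiRG.FST4.InDispersionClass L δ₀ g₀ G₀ w₀ (fun p : Momentum => squareDispersion 1 0 p - μ)) ↔
      μ < -2 := by
  constructor
  · rintro ⟨δ₀, g₀, G₀, w₀, -, h⟩
    by_contra hle
    push Not at hle
    exact klfs_fst4_not_inDispersionClass_openCell hle hμ₂ L hL hFo δ₀ g₀ G₀ w₀ h
  · intro hμ
    have hK := umklappRadius_lt_pi_div_two hμ₁.le hμ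
    have hsq : 0 < Real.sqrt (-μ * (4 + μ)) := Real.sqrt_pos.2 (by nlinarith)
    have hsq2 : Real.sqrt (-μ * (4 + μ)) ≤ 2 := by
      rw [show (2 : ℝ) = Real.sqrt (2 ^ 2) by rw [Real.sqrt_sq (by norm_num)]]
      exact Real.sqrt_le_sqrt (by nlinarith)
    refine ⟨(π / 2 - umklappRadius μ) / 2, Real.sqrt (-μ * (4 + μ)) / 2, 9 * (4 - μ) + 1, -μ / 4,
      ⟨by linarith, by linarith, by linarith, ?_⟩,
      klfs_fst4_inDispersionClass hμ₁ hμ L hL hFo (by linarith) (by linarith) (by linarith) (by linarith)⟩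
    exact max_lt (by linarith) (by linarith)

end Summit.HubbardSuperconductivity.HubbardSuperconductivity.Theorems

end
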